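import Summits.CriticalPhenomena.PercolationContinuityZ3.Theorems.PercNearOneGluingAdditiveGluingFingerML3Reductions
import Literature.Probability.Percolation.KozmaNitzanPreFKG
import Literature.Probability.LatticeModels.ProdBernoulliBK
import HarnessLib

/-! # Crux `PercNearOneGluing.AdditiveGluing` (stmt-CriticalPhenomena-4576) — the finger multi-edge Lemma 3 does not feel the
# pairs at the designation: WLOG no finger touches `d` (seat (b) V⁺-form, depth prover `png-dp-vplus`)

Support file (`--supports stmt-CriticalPhenomena-4576`); no definitions, no named facts.  Companion of
`…AdditiveGluingFingerML3Reductions.lean` (`fingerML3_of_dPairsKilled`: the CONCLUSION of `stub_fingerML3_vp` for `K` follows from the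
conclusion for `K' = K ⊖ (N–d)`, the pairs `s(v,d)`, `v ∈ N`, killed).

Here the HYPOTHESIS is transferred as well: `μ_K(d↔b) ≤ μ_K(a↔b) ⟹ μ_{K'}(d↔b) ≤ μ_{K'}(a↔b)` (`fingerML3_hyp_dPairsKilled`) — Kozma–Nitzan's
Lemma 3(ii) with the decreasing event "no pair `N–d` is open", which is read on the open edge cluster of the weak vertex `d` (an open pair at
`d` belongs to `C_d`); conditioning on that cylinder is the killed weighting.  (The single-edge case is the landed `al5_hyp_delete_edge_at_d`,
the "dual Lemma 5" of task png-dp-al5.)  Consequently (`fingerML3_wlog_dUntouched`) it suffices to prove `stub_fingerML3_vp` for weightings in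
which no finger touches the designation `d` — the normal form used by the peel calculus (`…BlockPeel.lean`, `…BasePeel.lean`), where on
`{d ↮ N}` the cluster of `d` is a base cluster.
[cite: KozmaNitzan2024, Lemma 3(ii) (pp. 6–7), Lemma 5 (p. 13), §4 p. 20 (conditioning on patterns)]
-/

namespace Summit.CriticalPhenomena.PercolationContinuityZ3.Theorems

open MeasureTheory Set
open Literature.Probability.LatticeModels (prodBernoulli)
open Literature.Probability.Percolation (BondConfig openConn openGraph openEdgeCluster pinW localCylinder
  DeterminedBy determinedBy_iff)

noncomputable section
open Classical

section StripD

open Literature.Probability.LatticeModels Literature.Probability.Percolation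

variable {n : ℕ}

/-- **The unglued comparison survives killing the pairs at the weak vertex.**  `d ∉ N`; `K' = K` with the pairs `s(v,d)` (`v ∈ N`) killed.
If `μ_K(d↔b) ≤ μ_K(a↔b)` and no pair `s(v,d)` has weight `1`, then `μ_{K'}(d↔b) ≤ μ_{K'}(a↔b)`.  (KN Lemma 3(ii) with the decreasing
`C_d`-event "no pair `N–d` open" + `prodBernoulli_real_inter_localCylinder`.)  [cite: KozmaNitzan2024, Lemma 3(ii) (pp. 6–7)] -/
theorem fingerML3_hyp_dPairsKilled (K : Sym2 (Fin n) → unitInterval) (N : Finset (Fin n)) (d a b : Fin n) (hdN : d ∉ N)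
    (hlt : ∀ v ∈ N, (K s(v, d) : ℝ) < 1)
    (hle : (prodBernoulli K).real (openConn d b) ≤ (prodBernoulli K).real (openConn a b)) :
    (prodBernoulli (fun e' : Sym2 (Fin n) => if (∃ v ∈ N, e' = s(v, d)) then (0 : unitInterval) else K e')).real (openConn d b) ≤
      (prodBernoulli (fun e' : Sym2 (Fin n) => if (∃ v ∈ N, e' = s(v, d)) then (0 : unitInterval) else K e')).real (openConn a b) := by
  set Fd : Finset (Sym2 (Fin n)) := N.image (fun v => s(v, d)) with hFd
  set K' : Sym2 (Fin n) → unitInterval := fun e' => if (∃ v ∈ N, e' = s(v, d)) then (0 : unitInterval) else K e' with hK'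
  -- the event "no pair of `Fd` open" read on the edge cluster of `d`
  set 𝒬 : Set (Set (Sym2 (Fin n))) := {C | ∀ e ∈ Fd, e ∉ C} with h𝒬
  have h𝒬low : IsLowerSet 𝒬 := fun C C' hCC' hC e he heC' => hC e he (hCC' heC')
  have hev : {ω : BondConfig (Fin n) | openEdgeCluster ω d ∈ 𝒬} = localCylinder (↑Fd : Set (Sym2 (Fin n))) (∅ : Set (Sym2 (Fin n))) := by
    ext ω
    simp only [Set.mem_setOf_eq, localCylinder, Finset.mem_coe, Set.mem_empty_iff_false, iff_false]
    constructor
    · intro h e he heω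
      obtain ⟨v, hv, rfl⟩ := Finset.mem_image.1 he
      have hvd : v ≠ d := fun h' => hdN (h' ▸ hv)
      refine h _ he ((mem_openEdgeCluster_iff ω d _).2 ⟨heω, fun hdiag => hvd (Sym2.mk_isDiag_iff.1 hdiag), ?_⟩)
      intro x hx
      rcases Sym2.mem_iff.1 hx with rfl | rfl
      · exact ((openGraph_adj ω d x).2 ⟨by rw [Sym2.eq_swap]; exact heω, hvd.symm⟩).reachable
      · exact SimpleGraph.Reachable.refl _
    · intro h C hC hCω
      exact h C hC (openEdgeCluster_subset ω d hCω)
  have h3 := KozmaNitzan2024_lemma3_ii K d a b le_rfl (by rw [add_zero]; exact hle) h𝒬low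
  rw [add_zero, hev] at h3
  have hmeas : ∀ s : Set (BondConfig (Fin n)), MeasurableSet s := fun _ => MeasurableSet.of_discrete
  rw [prodBernoulli_real_inter_localCylinder K Fd (∅ : Set (Sym2 (Fin n))) (hmeas _),
    prodBernoulli_real_inter_localCylinder K Fd (∅ : Set (Sym2 (Fin n))) (hmeas _)] at h3
  -- the killed weighting is the pinned one
  have hpin : pinW K (↑Fd : Set (Sym2 (Fin n))) (∅ : Set (Sym2 (Fin n))) = K' := by
    funext e
    by_cases he : e ∈ (↑Fd : Set (Sym2 (Fin n)))
    · rw [pinW_apply_of_mem_of_not_mem K he (Set.notMem_empty e)]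
      obtain ⟨v, hv, rfl⟩ := Finset.mem_image.1 (Finset.mem_coe.1 he)
      have : ∃ v' ∈ N, s(v, d) = s(v', d) := ⟨v, hv, rfl⟩
      simp only [hK', this, if_true]
    · rw [pinW_apply_of_not_mem K _ he]
      have : ¬ (∃ v' ∈ N, e = s(v', d)) := by
        rintro ⟨v', hv', rfl⟩
        exact he (Finset.mem_coe.2 (Finset.mem_image.2 ⟨v', hv', rfl⟩))
      simp only [hK', this, if_false]
  rw [hpin] at h3
  -- the cylinder has positive mass (no pair at `d` is surely open)
  have hpos : 0 < (prodBernoulli K).real (localCylinder (↑Fd : Set (Sym2 (Fin n))) (∅ : Set (Sym2 (Fin n)))) := by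
    have hcyl : localCylinder (↑Fd : Set (Sym2 (Fin n))) (∅ : Set (Sym2 (Fin n))) =
        {ω : Set (Sym2 (Fin n)) | ∀ (i) (h : i ∈ Fd), i ∈ ω ↔ (fun _ : Fd => false) ⟨i, h⟩ = true} := by
      ext ω
      simp only [localCylinder, Finset.mem_coe, Set.mem_empty_iff_false, Set.mem_setOf_eq, Bool.false_eq_true]
    rw [hcyl, prodBernoulli_real_cylinder_pattern K Fd (fun _ => false)]
    refine Finset.prod_pos fun i _ => ?_
    simp only [Bool.false_eq_true, if_false]
    obtain ⟨v, hv, hvi⟩ := Finset.mem_image.1 i.2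
    have h1 := hlt v hv
    rw [hvi] at h1
    linarith
  exact le_of_mul_le_mul_left h3 hpos


/-- **WLOG no finger touches the designation.**  Fix `A, N, d, b` (`b, d ∈ A`, `Disjoint N A`).  If the conclusion of `stub_fingerML3_vp`
holds for every finger weighting `K'` in which no pair `N–d` has positive weight (under the stub's hypotheses for `K'`), then it holds for
every finger weighting `K`.  Proof: if some pair `s(v,d)` is surely open then `d` is below the block vertex `v` and `fingerML3_of_le_blockVertex`
applies; otherwise kill the pairs `N–d` (`fingerML3_hyp_dPairsKilled` transfers the hypothesis, `fingerML3_of_dPairsKilled` the conclusion).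
[cite: KozmaNitzan2024, Lemma 3(ii) (pp. 6–7), Lemma 5 (p. 13)] -/
theorem fingerML3_wlog_dUntouched (A N : Finset (Fin n)) (d b : Fin n) (hb : b ∈ A) (hNA : Disjoint N A) (hd : d ∈ A)
    (hred : ∀ K' : Sym2 (Fin n) → unitInterval,
      (∀ v ∈ N, (K' s(v, d) : ℝ) = 0) →
      (∀ v ∈ N, ∀ y : Fin n, y ∉ A → y ∉ N → (K' s(v, y) : ℝ) = 0) →
      (∀ a ∈ A, (prodBernoulli K').real (openConn d b) ≤ (prodBernoulli K').real (openConn a b)) →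
      (prodBernoulli (fun e' : Sym2 (Fin n) => if (∀ y ∈ e', y ∈ N) ∧ ¬ e'.IsDiag then 1 else K' e')).real
          ({ω : Set (Sym2 (Fin n)) | ∃ v ∈ N, ∃ a ∈ A, s(v, a) ∈ ω} ∩ openConn d b) ≤
        (prodBernoulli (fun e' : Sym2 (Fin n) => if (∀ y ∈ e', y ∈ N) ∧ ¬ e'.IsDiag then 1 else K' e')).real
          ({ω : Set (Sym2 (Fin n)) | ∃ v ∈ N, ∃ a ∈ A, s(v, a) ∈ ω} ∩ ⋃ v ∈ N, openConn v b))
    (K : Sym2 (Fin n) → unitInterval)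
    (hfree : ∀ v ∈ N, ∀ y : Fin n, y ∉ A → y ∉ N → (K s(v, y) : ℝ) = 0)
    (hle : ∀ a ∈ A, (prodBernoulli K).real (openConn d b) ≤ (prodBernoulli K).real (openConn a b)) :
    (prodBernoulli (fun e' : Sym2 (Fin n) => if (∀ y ∈ e', y ∈ N) ∧ ¬ e'.IsDiag then 1 else K e')).real
        ({ω : Set (Sym2 (Fin n)) | ∃ v ∈ N, ∃ a ∈ A, s(v, a) ∈ ω} ∩ openConn d b) ≤
      (prodBernoulli (fun e' : Sym2 (Fin n) => if (∀ y ∈ e', y ∈ N) ∧ ¬ e'.IsDiag then 1 else K e')).real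
        ({ω : Set (Sym2 (Fin n)) | ∃ v ∈ N, ∃ a ∈ A, s(v, a) ∈ ω} ∩ ⋃ v ∈ N, openConn v b) := by
  have hdN : d ∉ N := Finset.disjoint_left.1 hNA.symm hd
  by_cases hone : ∃ v ∈ N, K s(v, d) = 1
  · -- a sure pair `v–d`: `d` is below the block vertex `v`
    obtain ⟨v, hv, h1⟩ := hone
    have hvd : v ≠ d := fun h => hdN (h ▸ hv)
    have hae := prodBernoulli_ae_mem_of_eq_one K h1
    have hle_v : (prodBernoulli K).real (openConn d b) ≤ (prodBernoulli K).real (openConn v b) := by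
      refine ENNReal.toReal_mono (measure_ne_top _ _) (measure_mono_ae ?_)
      filter_upwards [hae] with ω hω hdb
      exact ((openGraph_adj ω v d).2 ⟨hω, hvd⟩).reachable.trans hdb
    exact fingerML3_of_le_blockVertex K A N d b v hb hNA hv hfree hle_v
  · push Not at hone
    have hlt : ∀ v ∈ N, (K s(v, d) : ℝ) < 1 := by
      intro v hv
      have hne : K s(v, d) ≠ 1 := hone v hv
      have hle1 : (K s(v, d) : ℝ) ≤ 1 := (K s(v, d)).2.2
      rcases hle1.lt_or_eq with h | h
      · exact h
      · exact (hne (Subtype.ext h)).elim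
    set K' : Sym2 (Fin n) → unitInterval := fun e' => if (∃ v ∈ N, e' = s(v, d)) then (0 : unitInterval) else K e' with hK'
    have h0 : ∀ v ∈ N, (K' s(v, d) : ℝ) = 0 := by
      intro v hv
      have : ∃ v' ∈ N, s(v, d) = s(v', d) := ⟨v, hv, rfl⟩
      simp only [hK', this, if_true]
      rfl
    have hfree' : ∀ v ∈ N, ∀ y : Fin n, y ∉ A → y ∉ N → (K' s(v, y) : ℝ) = 0 := by
      intro v hv y hyA hyN
      by_cases hy : ∃ v' ∈ N, s(v, y) = s(v', d)
      · simp only [hK', hy, if_true]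
        rfl
      · simp only [hK', hy, if_false]
        exact hfree v hv y hyA hyN
    have hle' : ∀ a ∈ A, (prodBernoulli K').real (openConn d b) ≤ (prodBernoulli K').real (openConn a b) :=
      fun a ha => fingerML3_hyp_dPairsKilled K N d a b hdN hlt (hle a ha)
    exact fingerML3_of_dPairsKilled K A N d b hd hdN (hred K' h0 hfree' hle')

end StripD

end

end Summit.CriticalPhenomena.PercolationContinuityZ3.Theorems
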